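import Mathlib

/-! Sanity proofs (planner elab check only) for the cheap helper statements H1, H2, H5. -/

namespace SanityK3

theorem prod_forms_w {R : Type*} [CommRing R] (θ u w β₂ β₃ : R) (h₂ : β₂ = -3 - 5 * θ)
    (h₃ : β₃ = -8 + 5 * θ) (hθ : θ * θ = θ + 1) :
    ∏ i : Fin 3, ((![1, 1, 0] : Fin 3 → R) i * u + (![β₂, β₃, 1] : Fin 3 → R) i * w) =
      (u ^ 2 - 11 * u * w - w ^ 2) * w := by
  rw [Fin.prod_univ_three]
  simp only [Matrix.cons_val_zero, Matrix.cons_val_one, Matrix.cons_val]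
  rw [h₂, h₃]
  linear_combination (-(25 : R) * w ^ 3) * hθ

theorem prod_forms_u {R : Type*} [CommRing R] (θ u w β₂ β₃ : R) (h₂ : β₂ = -3 - 5 * θ)
    (h₃ : β₃ = -8 + 5 * θ) (hθ : θ * θ = θ + 1) :
    ∏ i : Fin 3, ((![1, 1, 1] : Fin 3 → R) i * u + (![β₂, β₃, 0] : Fin 3 → R) i * w) =
      (u ^ 2 - 11 * u * w - w ^ 2) * u := by
  rw [Fin.prod_univ_three]
  simp only [Matrix.cons_val_zero, Matrix.cons_val_one, Matrix.cons_val]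
  rw [h₂, h₃]
  linear_combination (-(25 : R) * u * w ^ 2) * hθ

theorem nonprop_w {R : Type*} [CommRing R] [Nontrivial R] {β₂ β₃ : R} (h23 : β₂ ≠ β₃) :
    ∀ i j : Fin 3, i ≠ j →
      (![1, 1, 0] : Fin 3 → R) i * (![β₂, β₃, 1] : Fin 3 → R) j ≠
        (![1, 1, 0] : Fin 3 → R) j * (![β₂, β₃, 1] : Fin 3 → R) i := by
  intro i j hij
  fin_cases i <;> fin_cases j <;> simp [h23, h23.symm] at hij ⊢

theorem nonprop_u {R : Type*} [CommRing R] {β₂ β₃ : R} (h23 : β₂ ≠ β₃) (h2 : β₂ ≠ 0)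
    (h3 : β₃ ≠ 0) :
    ∀ i j : Fin 3, i ≠ j →
      (![1, 1, 1] : Fin 3 → R) i * (![β₂, β₃, 0] : Fin 3 → R) j ≠
        (![1, 1, 1] : Fin 3 → R) j * (![β₂, β₃, 0] : Fin 3 → R) i := by
  intro i j hij
  fin_cases i <;> fin_cases j <;> simp [h23, h23.symm, h2, h3, h2.symm, h3.symm] at hij ⊢

theorem min_combine {L κ₁ κ₂ X A a b : ℝ} (hX : 0 ≤ X) (hA : 0 ≤ A) (ha : 0 ≤ a) (hb : 0 ≤ b)
    (hκ₁ : 0 ≤ κ₁) (hκ₂ : 0 ≤ κ₂)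
    (h₁ : L ≤ κ₁ * X * (A * a ^ (2 / 3 : ℝ))) (h₂ : L ≤ κ₂ * X * (A * b ^ (2 / 3 : ℝ))) :
    L ≤ max κ₁ κ₂ * X * (A * (min a b) ^ (2 / 3 : ℝ)) := by
  rcases le_total a b with hab | hab
  · rw [min_eq_left hab]
    refine h₁.trans ?_
    have h0 : 0 ≤ X * (A * a ^ (2 / 3 : ℝ)) := by positivity
    calc κ₁ * X * (A * a ^ (2 / 3 : ℝ)) = κ₁ * (X * (A * a ^ (2 / 3 : ℝ))) := by ring
      _ ≤ max κ₁ κ₂ * (X * (A * a ^ (2 / 3 : ℝ))) :=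
          mul_le_mul_of_nonneg_right (le_max_left _ _) h0
      _ = _ := by ring
  · rw [min_eq_right hab]
    refine h₂.trans ?_
    have h0 : 0 ≤ X * (A * b ^ (2 / 3 : ℝ)) := by positivity
    calc κ₂ * X * (A * b ^ (2 / 3 : ℝ)) = κ₂ * (X * (A * b ^ (2 / 3 : ℝ))) := by ring
      _ ≤ max κ₁ κ₂ * (X * (A * b ^ (2 / 3 : ℝ))) :=
          mul_le_mul_of_nonneg_right (le_max_right _ _) h0
      _ = _ := by ring

/-- H4 sanity. -/
theorem real_step_third {L C ε : ℝ} {P C₀ A B R : ℕ} (hε : 0 < ε)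
    (hL : L ≤ C * (P : ℝ) ^ (1 / (3 : ℝ) + ε / 2)) (hP : P ≤ C₀ * (A ^ 2 * B ^ 2))
    (hAB : A * B ≤ R) :
    L ≤ (max C 0 * (C₀ : ℝ) ^ (1 / (3 : ℝ) + ε / 2)) * (R : ℝ) ^ (ε : ℝ) *
      ((A : ℝ) ^ (2 / 3 : ℝ) * (B : ℝ) ^ (2 / 3 : ℝ)) := by
  set e : ℝ := 1 / (3 : ℝ) + ε / 2 with he
  have he0 : 0 ≤ e := by rw [he]; positivity
  have hPR : (P : ℝ) ≤ (C₀ : ℝ) * ((A : ℝ) ^ 2 * (B : ℝ) ^ 2) := by exact_mod_cast hP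
  have hPe : (P : ℝ) ^ e ≤ ((C₀ : ℝ) * ((A : ℝ) ^ 2 * (B : ℝ) ^ 2)) ^ e :=
    Real.rpow_le_rpow (Nat.cast_nonneg _) hPR he0
  have hA0 : (0 : ℝ) ≤ A := Nat.cast_nonneg _
  have hB0 : (0 : ℝ) ≤ B := Nat.cast_nonneg _
  have hABR : (A : ℝ) * B ≤ R := by exact_mod_cast hAB
  -- split the power
  have hsplit : ((C₀ : ℝ) * ((A : ℝ) ^ 2 * (B : ℝ) ^ 2)) ^ e =
      (C₀ : ℝ) ^ e * (((A : ℝ) * B) ^ (ε : ℝ) * ((A : ℝ) ^ (2 / 3 : ℝ) * (B : ℝ) ^ (2 / 3 : ℝ))) := by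
    rw [Real.mul_rpow (Nat.cast_nonneg _) (by positivity)]
    congr 1
    have hA2 : ((A : ℝ) ^ 2) = (A : ℝ) ^ (2 : ℝ) := by norm_cast
    have hB2 : ((B : ℝ) ^ 2) = (B : ℝ) ^ (2 : ℝ) := by norm_cast
    rw [Real.mul_rpow (by positivity) (by positivity), hA2, hB2, ← Real.rpow_mul hA0, ← Real.rpow_mul hB0,
      Real.mul_rpow hA0 hB0]
    have h1 : (A : ℝ) ^ (2 * e) = (A : ℝ) ^ (ε : ℝ) * (A : ℝ) ^ (2 / 3 : ℝ) := by
      rw [← Real.rpow_add' hA0]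
      · congr 1; rw [he]; ring
      · positivity
    have h2 : (B : ℝ) ^ (2 * e) = (B : ℝ) ^ (ε : ℝ) * (B : ℝ) ^ (2 / 3 : ℝ) := by
      rw [← Real.rpow_add' hB0]
      · congr 1; rw [he]; ring
      · positivity
    rw [h1, h2]; ring
  have hmono : ((A : ℝ) * B) ^ (ε : ℝ) ≤ (R : ℝ) ^ (ε : ℝ) :=
    Real.rpow_le_rpow (by positivity) hABR hε.le
  have hPe0 : 0 ≤ (P : ℝ) ^ e := Real.rpow_nonneg (Nat.cast_nonneg _) e
  have hT0 : 0 ≤ (A : ℝ) ^ (2 / 3 : ℝ) * (B : ℝ) ^ (2 / 3 : ℝ) := by positivity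
  calc L ≤ C * (P : ℝ) ^ e := hL
    _ ≤ max C 0 * (P : ℝ) ^ e := mul_le_mul_of_nonneg_right (le_max_left _ _) hPe0
    _ ≤ max C 0 * (((C₀ : ℝ) * ((A : ℝ) ^ 2 * (B : ℝ) ^ 2)) ^ e) :=
        mul_le_mul_of_nonneg_left hPe (le_max_right _ _)
    _ = max C 0 * (C₀ : ℝ) ^ e * (((A : ℝ) * B) ^ (ε : ℝ) * ((A : ℝ) ^ (2 / 3 : ℝ) * (B : ℝ) ^ (2 / 3 : ℝ))) := by
        rw [hsplit, mul_assoc]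
    _ ≤ max C 0 * (C₀ : ℝ) ^ e * ((R : ℝ) ^ (ε : ℝ) * ((A : ℝ) ^ (2 / 3 : ℝ) * (B : ℝ) ^ (2 / 3 : ℝ))) := by
        apply mul_le_mul_of_nonneg_left (mul_le_mul_of_nonneg_right hmono hT0)
        exact mul_nonneg (le_max_right _ _) (Real.rpow_nonneg (Nat.cast_nonneg _) e)
    _ = _ := by ring

end SanityK3
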